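import Literature.AlgebraicGeometry.RelativeSpec.DescentOfUnitSameCharacter
import Mathlib.LinearAlgebra.Dimension.Finite
import HarnessLib

/-!
# At most `#G` pairwise non-isomorphic modules on a free finite quotient `X/G` become trivial on `X`
# ([MumfordAV1970] §12 Thm. 1 / §15 Thm. 1: `#ker(Pic(X/G) → Pic X) ≤ #Hom(G, Γ(X,𝒪)ˣ) ≤ #G`)

Layer `Literature/AlgebraicGeometry/RelativeSpec`, namespace `Literature.AlgebraicGeometry.RelativeSpec.ActionOver`; sequel of ★
`DescentOfUnitSameCharacter`, same generic setting (`ρ : ActionOver p G`, `p : X ⟶ Q` an affine flat geometric quotient by a FREE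
action of the finite group `G`).  THEOREMS ONLY (no definition, no named fact, no instance, no `sorry`).

* §1 `exists_actSections_generator_eq_smul` — the generator `s = e(η_p 1)` of a trivialised pull-back `e : p^* 𝒪_Q ≅ p^* M` is an
  eigen-section of every `g ∈ G`: `g · s = a_g · s` (★ `exists_eq_smul_unitSection_one`);
* §2 **`finite_and_natCard_le_card_of_forall_iso`** — if `G` fixes the global functions of `X` and `Γ(X, 𝒪)` is a domain, a family
  `M : ι → Q.Modules` of PAIRWISE NON-ISOMORPHIC quasi-coherent modules with trivialised pull-backs is finite with `#ι ≤ #G`: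
  the eigenvalues form a monoid homomorphism `G → Γ(X, 𝒪)` (cocycle law ★ `actSections_mul` + `G` fixes `a_g`), the same
  homomorphism forces isomorphic modules (★ `nonempty_iso_of_actSections_eq_smul`), and distinct homomorphisms `G → Γ(X,𝒪)` are
  linearly independent in the free module `G → Γ(X, 𝒪)` of rank `#G` (Dedekind, Mathlib `linearIndependent_monoidHom`,
  `LinearIndependent.cardinalMk_le_finrank`).

Cell `hodgecm-mathlib` (D-0151), HECKE-LINK socket (B), brick (K5c-1) generic count (B-p02 (g11)); consumer: the complex-point kernel count
`AbelianSchemes/PoincarePullbackKernelCountComplex` (Mumford §15 Thm. 1 injectivity half).  Count-neutral.  HC_CM is proved only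
modulo the 7 printed citations until rung 0 closes.

## References
* [MumfordAV1970] D. Mumford, *Abelian Varieties* (1970), §12 Thm. 1 (p. 112), §15 Thm. 1 (p. 143).
* [Greither1992CyclicGalois] C. Greither, LNM 1534 (1992), Ch. 0 Thm. 7.1, Prop. 7.2 (pp. 28–29).
-/

set_option autoImplicit false

noncomputable section

-- `TopCat.Presheaf`/`Scheme.Modules` are not reducible (as in Mathlib's `AlgebraicGeometry/Modules`).
set_option backward.isDefEq.respectTransparency false

universe u v

open CategoryTheory Limits AlgebraicGeometry TopologicalSpace Opposite Cardinal
open Literature.AlgebraicGeometry.Modules Literature.AlgebraicGeometry.HodgeTheory Literature.AlgebraicGeometry.Motives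

namespace Literature.AlgebraicGeometry.RelativeSpec.ActionOver

variable {X Q : Scheme.{u}} {p : X ⟶ Q} {G : Type u} [Group G] (ρ : ActionOver p G)

/-! ## §1 The eigenvalue of the generator exists and is unique; it is a character when `G` fixes the global functions -/

section Character

variable (M : Q.Modules)
  (e : (Scheme.Modules.pullback p).obj (SheafOfModules.unit Q.ringCatSheaf) ≅ (Scheme.Modules.pullback p).obj M)

/-- **The generator `s = e(η_p 1)` of a trivialised pull-back is an eigen-section of every `g`**: `g · s = a · s` for some global
function `a` (★ `exists_eq_smul_unitSection_one` transported along `e`). [cite: MumfordAV1970, §12 Thm. 1 (p. 112)] -/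
theorem exists_actSections_generator_eq_smul (g : G) :
    ∃ a : Γ(X, p ⁻¹ᵁ ⊤), ρ.actSections _ (EquivariantStructure.ofPullback ρ M).iso g ⊤
        (e.hom.app (p ⁻¹ᵁ ⊤) (unitSection p (SheafOfModules.unit Q.ringCatSheaf) ⊤ (1 : Γ(Q, ⊤)))) =
      a • e.hom.app (p ⁻¹ᵁ ⊤) (unitSection p (SheafOfModules.unit Q.ringCatSheaf) ⊤ (1 : Γ(Q, ⊤))) := by
  obtain ⟨a, ha⟩ := exists_eq_smul_unitSection_one (p := p) ⊤ (e.inv.app (p ⁻¹ᵁ ⊤)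
    (ρ.actSections _ (EquivariantStructure.ofPullback ρ M).iso g ⊤
      (e.hom.app (p ⁻¹ᵁ ⊤) (unitSection p (SheafOfModules.unit Q.ringCatSheaf) ⊤ (1 : Γ(Q, ⊤))))))
  refine ⟨a, ?_⟩
  rw [← Scheme.Modules.Hom.app_smul, ← ha, ← CategoryTheory.comp_apply, ← Scheme.Modules.Hom.comp_app, e.inv_hom_id,
    Scheme.Modules.Hom.id_app, CategoryTheory.id_apply]

end Character

/-! ## §2 The count -/

section Count

variable [Fintype G]

/-- **At most `#G` pairwise non-isomorphic quasi-coherent modules on `Q = X/G` have trivial pull-back to `X`** — when `p : X → Q`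
is an affine flat geometric quotient by a FREE action of the finite group `G`, `G` fixes the global functions of `X`, and
`Γ(X, 𝒪)` is a domain: the eigenvalue character `g ↦ a_g` of the generator of `p^* M_i` (§1) is a monoid homomorphism
`G → Γ(X, 𝒪)` (cocycle + `G` fixes `a_g`), modules with the same character are isomorphic (★ `nonempty_iso_of_actSections_eq_smul`),
and distinct characters `G → Γ(X, 𝒪)` are linearly independent (Dedekind, Mathlib `linearIndependent_monoidHom`), so at most
`#G` of them exist.  [MumfordAV1970] §12 Thm. 1 / §15 Thm. 1: `ker(Pic(X/G) → Pic X) ↪ Hom(G, Γ(X, 𝒪_X)ˣ)`, `# ≤ #G`.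
[cite: MumfordAV1970, §12 Thm. 1 (p. 112) and §15 Thm. 1 (p. 143)] -/
theorem finite_and_natCard_le_card_of_forall_iso [IsAffineHom p] [Flat p] (hq : ρ.IsGeometricQuotient p)
    (hfree : ∀ (V : Q.Opens), IsAffineOpen V → ∀ g : G, g ≠ 1 →
      Ideal.span (Set.range fun b : Γ(X, p ⁻¹ᵁ V) ↦ ρ.act g V b - b) = ⊤)
    (hfix : ∀ (g : G) (b : Γ(X, p ⁻¹ᵁ ⊤)),
      (ρ.aut g).hom.appLE (p ⁻¹ᵁ ⊤) (p ⁻¹ᵁ ⊤) (ρ.preimage_preimage g ⊤).ge b = b)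
    [IsDomain Γ(X, p ⁻¹ᵁ ⊤)] {ι : Type v} (M : ι → Q.Modules)
    [∀ i, ((Scheme.Modules.pullback p).obj (M i)).IsQuasicoherent]
    (e : ∀ i, (Scheme.Modules.pullback p).obj (SheafOfModules.unit Q.ringCatSheaf) ≅ (Scheme.Modules.pullback p).obj (M i))
    (hinj : ∀ i j, Nonempty (M i ≅ M j) → i = j) :
    Finite ι ∧ Nat.card ι ≤ Fintype.card G := by
  classical
  -- the eigenvalue characters
  choose a ha using fun i g => ρ.exists_actSections_generator_eq_smul (M i) (e i) g
  -- they are monoid homomorphisms `G → Γ(X, 𝒪)`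
  have hone : ∀ i, a i 1 = 1 := fun i => by
    refine eq_of_smul_generator_eq (p := p) (M i) (e i) ⊤ _ _ ?_
    rw [← ha i 1, one_smul]
    exact ρ.actSections_one _ _ (EquivariantStructure.ofPullback ρ (M i)).iso_one_hom ⊤ _
  have hmul : ∀ i g h, a i (g * h) = a i g * a i h := fun i g h => by
    refine eq_of_smul_generator_eq (p := p) (M i) (e i) ⊤ _ _ ?_
    rw [← ha i (g * h), ρ.actSections_mul _ _ (EquivariantStructure.ofPullback ρ (M i)).iso_mul_hom g h ⊤ _, ha i g,
      ρ.actSections_smul, hfix, ha i h, smul_smul]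
  let χ : ι → (G →* Γ(X, p ⁻¹ᵁ ⊤)) := fun i =>
    { toFun := a i, map_one' := hone i, map_mul' := hmul i }
  -- injectivity: same character ⇒ isomorphic ⇒ same index
  have hχ : Function.Injective χ := by
    intro i j hij
    have haij : a i = a j := funext fun g => by
      have := DFunLike.congr_fun hij g
      exact this
    obtain ⟨iso⟩ := ρ.nonempty_iso_of_actSections_eq_smul hq hfree (M i) (M j) (e i) (e j) (a i) (ha i)
      (fun g => by rw [haij]; exact ha j g)
    exact (hinj j i ⟨iso⟩).symm
  -- Dedekind: the characters are linearly independent in `G → Γ(X, 𝒪)`, a free module of rank `#G`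
  have hli := (linearIndependent_monoidHom G Γ(X, p ⁻¹ᵁ ⊤)).comp χ hχ
  have hcard : #ι ≤ Fintype.card G := by
    have h := hli.cardinalMk_le_finrank
    rwa [Module.finrank_fintype_fun_eq_card] at h
  have hfin : Finite ι := by
    rw [← Cardinal.lt_aleph0_iff_finite]
    exact lt_of_le_of_lt hcard (Cardinal.natCast_lt_aleph0)
  refine ⟨hfin, ?_⟩
  haveI := Fintype.ofFinite ι
  rw [Nat.card_eq_fintype_card]
  exact_mod_cast (Cardinal.mk_fintype ι ▸ hcard : ((Fintype.card ι : ℕ) : Cardinal) ≤ Fintype.card G)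

end Count

end Literature.AlgebraicGeometry.RelativeSpec.ActionOver
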